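import Literature.NumberTheory.Automorphic.ShimuraCurveTakahashiCoordinateInputs
import Literature.NumberTheory.EllipticCurves.PastenHeightBoundsLemma68LocalProofs
import Literature.NumberTheory.EllipticCurves.ManinConstantArbitraryParametrizationIntegralProofs
import Literature.NumberTheory.EllipticCurves.KenkuMinimalLevels
import Literature.NumberTheory.EllipticCurves.TakahashiDegreeFormulaCoprimeProofs
import Literature.NumberTheory.Automorphic.ShimuraParametrizationExistenceProofs
import Literature.NumberTheory.Automorphic.BCDTModularity
import HarnessLib

/-!
# Stub-ideation k1 (GEN 3) — crux `SteinbergCore` (stmt-ABC-15024), line `p6_tamagawa_split`,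
# stub `stub_xiDegreeComparison` — FAMILY 1 (recognise & import): elaboration sanity

Companion of `STUB-IDEAS-stub_xiDegreeComparison-1.md` (gen 3).  Three parts:

* Part A (CHECKED, rc 0): the INPUTS of the by-name helpers H1/H2, by name, on a LITERATURE-ONLY import
  cone — (I1) the section hypotheses `hTlev`/`hT2` of p162272 ARE the named facts
  `takahashi2001_thm_2_3_shimura_level` / `takahashi2001_thm_2_3_shimura_disc`; (I2) the Literature bodies
  of the route items `IsogenyValuationTransport` (= Pasten L.6.8, `Iff.rfl` in
  `DefiniteXiXiStrongBoundItemsCalibration`) and `MazurKenkuBound` (= `…minimalDegree_le_163_mul`, `Iff.rfl`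
  ibid.) from Mazur–Kenku; (I3) the discharge chains one level down resolve by name.
* Part B (CHECKED, rc 0, PROVED): H3 `dvd_of_integral_equivariant_transfer`, the pure-algebra core of the
  theta-lattice transfer (ideator k2's H5core) — Mathlib only, 0 sorries.
* Part C (text only, in the trailing comment): the one-line compositions H1/H1′/H2/H2′ over the landed
  consumers p162272 / p137891.  They import `Summits.ABC.ABC.Theorems.*` modules whose oleans the farm
  snapshots report UNBUILT today (rc 75 `remote:stale:…:unbuilt:…SteinbergCore.Negative.SteinbergCoreDomain`,
  `…DefiniteXiXiStrongBoundValuationProductBound`, `…DefiniteXiFreyModularityIsModular`) — nothing to fix in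
  the terms; re-run when the snapshot is rebuilt (files `SketchByName.lean`, `SketchPrime.lean` of the seat folder).
-/

namespace Summit.ABC.ABC.Cruxes.SteinbergCore.StubIdeasK1G3

open Literature.NumberTheory.EllipticCurves Literature.NumberTheory.EllipticCurves.ModularForms
open Literature.NumberTheory.Automorphic

/-! ## (I1) `hTlev` / `hT2` of p162272 are the two named Shimura-curve facts -/

/-- `hTlev` of `XiDegreeComparisonItems.stub_xiDegreeComparison_of_items`, verbatim, from the named fact. -/
theorem hTlev_of_namedFact (h : takahashi2001_thm_2_3_shimura_level) :
    ∀ {N D M p m : ℕ}, p.Prime → M = p * m → ¬ p ∣ m →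
      Literature.NumberTheory.Automorphic.IsAdmissibleFactorization N D M →
      ∀ (X : Literature.NumberTheory.Automorphic.ShimuraCurveData D M) (W : WeierstrassCurve ℚ)
        [W.IsElliptic], W.conductorNorm ℤ = N →
      ∀ (W' : WeierstrassCurve ℚ) [W'.IsElliptic]
        (P : Literature.NumberTheory.Automorphic.ShimuraParametrizationData X W'), P.IsMinimalFor W →
      ∀ S : Literature.NumberTheory.Automorphic.Brandt.XiSetup m (D * p),
        ∃ i j : ℕ, 0 < i ∧ i * j = (W'.minimalDiscriminantNorm ℤ).factorization p ∧
          i ∣ S.xi (fun n => W'.LFunction n) ∧ P.deg * i = S.xi (fun n => W'.LFunction n) * j := h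

/-- `hT2` of `XiDegreeComparisonItems.stub_xiDegreeComparison_of_items`, verbatim, from the named fact. -/
theorem hT2_of_namedFact (h : takahashi2001_thm_2_3_shimura_disc) :
    ∀ {N D M p d : ℕ}, p.Prime → D = p * d →
      Literature.NumberTheory.Automorphic.IsAdmissibleFactorization N D M →
      ∀ (X : Literature.NumberTheory.Automorphic.ShimuraCurveData D M) (W : WeierstrassCurve ℚ)
        [W.IsElliptic], W.conductorNorm ℤ = N →
      ∀ (W' : WeierstrassCurve ℚ) [W'.IsElliptic]
        (P : Literature.NumberTheory.Automorphic.ShimuraParametrizationData X W'), P.IsMinimalFor W →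
      ∀ S : Literature.NumberTheory.Automorphic.Brandt.XiSetup (p * M) d,
        ∃ i j : ℕ, 0 < i ∧ i * j = (W'.minimalDiscriminantNorm ℤ).factorization p ∧
          i ∣ S.xi (fun n => W'.LFunction n) ∧ P.deg * i = S.xi (fun n => W'.LFunction n) * j := h

/-! ## (I2) the route items' Literature bodies from Mazur–Kenku, by name
(`IsogenyValuationTransport ↔ PastenShimura2024_lemma_6_8` and
`MazurKenkuBound ↔ PastenShimura2024_minimalDegree_le_163_mul` are `Iff.rfl`, landed in
`DefiniteXiXiStrongBoundItemsCalibration.lean`; `FreyModularity ⟸ BCDT.CDT_theorem_7_1_2` is the landed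
`Summit.ABC.ABC.Theorems.freyModularity_of_CDT_theorem_7_1_2'` — those Summits modules are not imported here.) -/

/-- Pasten Lemma 6.8 (= the item `IsogenyValuationTransport`, stmt-ABC-18928) from Mazur–Kenku. -/
theorem lemma68_of_mazurKenku (hMK : mazurKenku_exists_cyclic_isogeny) : PastenShimura2024_lemma_6_8 :=
  PastenShimura2024_lemma_6_8_of_mazurKenku' hMK

/-- `deg ≤ 163 · (optimal degree)` (= the item `MazurKenkuBound`, stmt-ABC-15125) from Mazur–Kenku. -/
theorem degLe163_of_mazurKenku (hMK : mazurKenku_exists_cyclic_isogeny) :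
    PastenShimura2024_minimalDegree_le_163_mul :=
  PastenShimura2024_minimalDegree_le_163_mul_of_mazurKenku' hMK

/-- CDT 1999 Thm. 7.1.2 resolves under this name (the input of `freyModularity_of_CDT_theorem_7_1_2'`). -/
example : Prop := BCDT.CDT_theorem_7_1_2

/-! ## (I3) one level further down, by name -/

/-- Mazur–Kenku ⟸ Mazur 1978 Thm. 1 (`mazur_isogeny_irreducible`) + Kenku's levels
(`kenku_minimalLevels_mem_kenkuDegrees`). -/
theorem mazurKenku_of_mazur_of_kenku (hM : mazur_isogeny_irreducible)
    (hK : kenku_minimalLevels_mem_kenkuDegrees) : mazurKenku_exists_cyclic_isogeny :=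
  mazurKenku_exists_cyclic_isogeny_of_mazur_of_kenku hM hK

/-- The three apex inputs of the PRIME-TYPE form resolve: Takahashi 2001 Thm. 2.3 at `r ∥ N` (`D = 1`),
Mazur–Kenku, CDT 7.1.2 — and so do the two extra inputs of the composite form (JL data, the two
Shimura-curve facts). -/
example : Prop := takahashi2001_thm_2_3_of_coprime ∧ mazurKenku_exists_cyclic_isogeny ∧ BCDT.CDT_theorem_7_1_2
  ∧ nonempty_shimuraParametrizationData ∧ takahashi2001_thm_2_3_shimura_level ∧ takahashi2001_thm_2_3_shimura_disc

/-- The `D = 1` fact from the `D = 1` Brandt dictionary (section form), and JL data from the automorphic half —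
the discharge theorems exist under these names. -/
example := @takahashi2001_thm_2_3_of_coprime_of_brandtDictionary_one'
example := @nonempty_shimuraParametrizationData_of_automorphicHalf
example := @nonempty_shimuraParametrizationData_iff_automorphicHalf
example := @takahashi2001_thm_2_3_shimura_level.deg_le_xi_mul
example := @takahashi2001_thm_2_3_shimura_disc.deg_le_xi_mul


/-! ## H3 — pure algebra: congruence transfer along an integral equivariant map (family-2 support) -/

/-- **H3 (congruence transfer).** Let `Θ : X → S` be additive with `Θ φ = c • f`, `B : X → ℤ` additive,
`K ≤ S` with `ℤ f ∩ K = 0` (`hindep`), `r • S ⊆ ℤ f + K` (`hcong`: `r` kills the congruence module of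
`f` in `S`), and `Θ (ξ • x − B x • φ) ∈ K` for all `x` (`hperp`: the `B`-orthogonal complement of `φ`,
cleared of the denominator `ξ = B φ`, maps into `K` — Hecke-equivariance + rank one of the eigen-line).
Then `ξ ∣ r · c · B x` for every `x`.  Application (theta-lattice line): `X` = Brandt module,
`B = ⟨φ, ·⟩_w`, `ξ = brandtXi`, `Θ = Θ_y`, `c = ⟨y, φ⟩_w`, `S = M₂(Γ₀(N), ℤ)`, `r` = congruence exponent
of `f`; conclusion `ξ ∣ r · ⟨φ,x⟩_w ⟨φ,y⟩_w`, i.e. `ξ ∣ r · g²`, `g = gcd_i (w_i φ_i) ∣ 12`. -/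
theorem dvd_of_integral_equivariant_transfer {X S : Type*} [AddCommGroup X] [AddCommGroup S]
    (B : X →+ ℤ) (Θ : X →+ S) (K : AddSubgroup S) (φ : X) (f : S) (ξ c r : ℤ)
    (hΘφ : Θ φ = c • f)
    (hperp : ∀ x : X, Θ (ξ • x - (B x) • φ) ∈ K)
    (hcong : ∀ s : S, ∃ a : ℤ, ∃ k ∈ K, r • s = a • f + k)
    (hindep : ∀ a : ℤ, a • f ∈ K → a = 0) :
    ∀ x : X, ξ ∣ r * c * B x := by
  intro x
  obtain ⟨a, k, hk, hak⟩ := hcong (Θ x)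
  -- `r • Θ (ξ • x) = (r * c * B x) • f + r • Θ (ξ • x - B x • φ)` and `= (ξ * a) • f + ξ • k`
  have h1 : Θ (ξ • x) = (B x * c) • f + Θ (ξ • x - (B x) • φ) := by
    have : Θ (ξ • x) = Θ (ξ • x - (B x) • φ) + Θ ((B x) • φ) := by
      rw [← map_add, sub_add_cancel]
    rw [this, map_zsmul, hΘφ, smul_smul, add_comm]
  have h2 : (ξ * a - r * c * B x) • f = r • Θ (ξ • x - (B x) • φ) - ξ • k := by
    have e1 : r • Θ (ξ • x) = (r * (B x * c)) • f + r • Θ (ξ • x - (B x) • φ) := by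
      rw [h1, smul_add, smul_smul]
    have e2 : r • Θ (ξ • x) = (ξ * a) • f + ξ • k := by
      rw [map_zsmul, smul_comm, hak, smul_add, smul_smul]
    have e3 : (ξ * a) • f + ξ • k = (r * (B x * c)) • f + r • Θ (ξ • x - (B x) • φ) := e2 ▸ e1
    have : (ξ * a) • f - (r * c * B x) • f = r • Θ (ξ • x - (B x) • φ) - ξ • k := by
      have hr : r * c * B x = r * (B x * c) := by ring
      rw [hr]
      exact sub_eq_sub_iff_add_eq_add.mpr (by rw [e3]; abel)
    rw [sub_smul]; exact this
  have hmem : (ξ * a - r * c * B x) • f ∈ K := by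
    rw [h2]
    exact K.sub_mem (K.zsmul_mem (hperp x) r) (K.zsmul_mem hk ξ)
  have h0 := hindep _ hmem
  exact ⟨a, by linarith⟩


/-! ## Part C — H1 / H1′ / H2 / H2′ by name over the landed consumers (TEXT ONLY today, see header)

    ```lean
    -- file SketchByName.lean (imports Summits.ABC.ABC.Theorems.DefiniteXiSteinbergCoreXiDegreeComparisonItems,
    --   Literature.NumberTheory.Automorphic.ShimuraCurveTakahashiCoordinateInputs,
    --   Literature.NumberTheory.EllipticCurves.PastenHeightBoundsLemma68LocalProofs,
    --   Summits.ABC.ABC.Theorems.DefiniteXiFreyModularityIsModular)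
    theorem xiDegreeComparison_of_namedFacts
        (hL : takahashi2001_thm_2_3_shimura_level) (hD : takahashi2001_thm_2_3_shimura_disc)
        (hIVT : IsogenyValuationTransport) (hJL : nonempty_shimuraParametrizationData)
        (hMod : FreyModularity) : Sig.XiDegreeComparison /- = the registered signature verbatim -/ :=
      Summit.ABC.ABC.Theorems.XiDegreeComparisonItems.stub_xiDegreeComparison_of_items hL hD hIVT hJL hMod

    theorem xiDegreeComparison_of_literatureFacts
        (hL : takahashi2001_thm_2_3_shimura_level) (hD : takahashi2001_thm_2_3_shimura_disc)
        (hMK : mazurKenku_exists_cyclic_isogeny) (hJL : nonempty_shimuraParametrizationData)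
        (h712 : BCDT.CDT_theorem_7_1_2) : Sig.XiDegreeComparison :=
      xiDegreeComparison_of_namedFacts hL hD
        (isogenyValuationTransport_iff.mpr (PastenShimura2024_lemma_6_8_of_mazurKenku' hMK)) hJL
        (Summit.ABC.ABC.Theorems.freyModularity_of_CDT_theorem_7_1_2' h712)

    -- file SketchPrime.lean (imports Summits.ABC.ABC.Theorems.DefiniteXiSteinbergCoreXiDegreeComparisonPrime,
    --   …PastenHeightBoundsLemma68LocalProofs, …ManinConstantArbitraryParametrizationIntegralProofs,
    --   Summits.ABC.ABC.Theorems.DefiniteXiFreyModularityIsModular)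
    theorem xiDegreeComparison_prime_of_literatureFacts
        (hT : takahashi2001_thm_2_3_of_coprime) (hMK : mazurKenku_exists_cyclic_isogeny)
        (h712 : BCDT.CDT_theorem_7_1_2) : Sig.XiDegreeComparisonPrime /- prime-type form, verbatim p137891 -/ :=
      Summit.ABC.ABC.Theorems.xiDegreeComparison_prime_of_facts hT
        (PastenShimura2024_minimalDegree_le_163_mul_of_mazurKenku' hMK)
        (PastenShimura2024_lemma_6_8_of_mazurKenku' hMK)
        (Summit.ABC.ABC.Theorems.freyModularity_of_CDT_theorem_7_1_2' h712)

    theorem xiDegreeComparisonPrime_of_stub (h : Sig.XiDegreeComparison) : Sig.XiDegreeComparisonPrime := by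
      intro ε hε
      obtain ⟨C, hC⟩ := h ε hε
      refine ⟨C, fun a b hab h0 N _ hN q hq hq2 hqN hξ => ?_⟩
      exact hC a b hab h0 N hN q (hq.odd_of_ne_two hq2) hq.squarefree
        (by rw [Nat.Prime.primeFactors hq, Finset.card_singleton]; exact odd_one) hqN hξ
    ```
-/

end Summit.ABC.ABC.Cruxes.SteinbergCore.StubIdeasK1G3
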